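import Literature.NumberTheory.Automorphic.CongruenceSubgroupFactorization
import Literature.NumberTheory.Automorphic.HeckeGelfandTrick
import HarnessLib

/-!
# Multiplicativity of the Hecke operators `[K₁ ϖ^a K₁]` along the dominant cone

Topic `NumberTheory/Automorphic`; theorems only (no definition, no named fact), on top of
`HeckeGelfandTrick` (the concrete Hecke operators `heckeOperator ρ J g = ∑_{yJ ⊆ JgJ} ρ(y)` on the
`J`-fixed vectors of a representation `ρ` of a group `G`, the pair count `heckePairCount` and the
product formula) and `CongruenceSubgroupFactorization` (`ϖ^a K₁ ϖ^b ⊆ K₁ ϖ^a ϖ^b K₁` for the first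
congruence subgroup `K₁ = 1 + 𝓂 M_n(𝒪)` of `GL_n` over a valued field and antitone `a, b`).

* `heckePairCount_eq_zero_of_not_mem_orbit_mul`, `heckeOperator_heckeOperator_apply_eq_smul`
  (**abstract multiplicativity**): for a subgroup `J ≤ G` and `x, y ∈ G` with the *expansion
  property* `x J y ⊆ J (xy) J`, the structure constants `N_{x,y}(γ)` of `𝟙_{JxJ} * 𝟙_{JyJ}`
  vanish off `J xy J`, hence on `V^J`
  `[JxJ] ([JyJ] v) = N_{x,y}(xyJ) • [J xy J] v`, with `1 ≤ N_{x,y}(xyJ)`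
  (`one_le_heckePairCount_mul`). (Casselman (1995), Lemma 4.1.5, in the counting form of
  Shimura (1971), Prop. 3.1–3.3 / Bump (1997), §4.6.)
* `exists_smul_heckeOperator_piPowGL_eq_prod` (**words in the fundamental operators**): for
  `G = GL_n(F)`, `J = K₁` and an antitone `a ∈ ℕⁿ` with `∑ a_i ≤ m`, there are `N ≥ 1` and a word
  `w = (ε_1, …, ε_ℓ)`, `ℓ ≤ m`, in the antitone `0/1`-vectors (`ϖ^ε = diag(ϖ 1_r, 1_{n-r})`, the
  fundamental dominant coweights) such that
  `N • [K₁ ϖ^a K₁] v = [K₁ ϖ^{ε_1} K₁] ⋯ [K₁ ϖ^{ε_ℓ} K₁] v` for every `v ∈ V^{K₁}` — peel off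
  `ε = min(a, 1)` and induct on `∑ a_i`.

These are the algebraic half of the exponential bound for spherical matrix coefficients of
admissible representations (`SphericalCoefficientGrowth`), replacing the asymptotics of spherical
functions (Macdonald's formula) in the unramified computation of Godement–Jacquet (1972),
Lemma 6.10.

## References

* W. Casselman, *Introduction to the theory of admissible representations of 𝔭-adic reductive
  groups* (1995 notes), Lemma 4.1.5.
* G. Shimura, *Introduction to the arithmetic theory of automorphic functions* (1971), §3.1
  [ShimuraIATAF1971]; D. Bump, *Automorphic Forms and Representations* (1997), §4.6 [Bump1997].
-/

noncomputable section

open scoped Pointwise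
open MulAction ValuativeRel Matrix

namespace Literature.NumberTheory.Automorphic

/-! ### Abstract multiplicativity from the expansion property `x J y ⊆ J xy J` -/

section Abstract

variable {k G V : Type*} [CommRing k] [Group G] [AddCommGroup V] [Module k V]
  (ρ : Representation k G V) (J : Subgroup G)

omit [CommRing k] in
/-- If `x J y ⊆ J (xy) J` then the pair count `N_{x,y}(γ) = #{α ∈ JxJ/J : α⁻¹ γ ∈ JyJ/J}`
vanishes for `γ ∉ J xy J / J`: every product of a coset in `JxJ` and a coset in `JyJ` lies in
`J xy J`. [folklore] -/
theorem heckePairCount_eq_zero_of_not_mem_orbit_mul {x y : G}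
    (hxy : ∀ j ∈ J, ∃ j₁ ∈ J, ∃ j₂ ∈ J, x * j * y = j₁ * (x * y) * j₂) {γ : G ⧸ J}
    (hγ : γ ∉ orbit J ((x * y : G) : G ⧸ J)) : heckePairCount J x y γ = 0 := by
  unfold heckePairCount
  suffices h : {α ∈ orbit J (x : G ⧸ J) | α.out⁻¹ • γ ∈ orbit J (y : G ⧸ J)} = ∅ by
    rw [h, Set.ncard_empty]
  ext α
  simp only [Set.mem_setOf_eq, Set.mem_empty_iff_false, iff_false, not_and]
  intro hα hαγ
  apply hγ
  obtain ⟨κ, hκ⟩ := (mem_orbit_mk_iff J).1 hα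
  obtain ⟨h, H⟩ := QuotientGroup.mk_out_eq_mul J ((κ : G) * x)
  rw [hκ] at H
  obtain ⟨κ', hκ'⟩ := (mem_orbit_mk_iff J).1 hαγ
  have hγ' : γ = (((κ : G) * x * h * ((κ' : G) * y) : G) : G ⧸ J) := by
    have e : γ = α.out • (α.out⁻¹ • γ) := (smul_inv_smul _ _).symm
    rw [e, ← hκ', H]
    rfl
  obtain ⟨j₁, hj₁, j₂, hj₂, hj⟩ := hxy ((h : G) * κ') (J.mul_mem h.2 κ'.2)
  rw [(mem_orbit_mk_iff J)]
  refine ⟨κ * ⟨j₁, hj₁⟩, ?_⟩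
  rw [hγ', QuotientGroup.eq]
  have e : ((κ : G) * x * h * ((κ' : G) * y)) = κ * (x * (h * κ') * y) := by group
  rw [e, hj]
  simp only [Subgroup.coe_mul]
  have e' : ((κ : G) * j₁ * (x * y))⁻¹ * ((κ : G) * (j₁ * (x * y) * j₂)) = j₂ := by group
  rw [e']
  exact hj₂

/-- The pair count at the product coset is positive: `N_{x,y}(xyJ) ≥ 1` (the pair `(xJ, yJ)`).
[folklore] -/
theorem one_le_heckePairCount_mul (x y : G) (hx : (orbit J (x : G ⧸ J)).Finite) :
    1 ≤ heckePairCount J x y ((x * y : G) : G ⧸ J) := by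
  unfold heckePairCount
  rw [Nat.one_le_iff_ne_zero, Ne, Set.ncard_eq_zero (hx.subset (Set.sep_subset _ _)),
    ← Ne, ← Set.nonempty_iff_ne_empty]
  refine ⟨(x : G ⧸ J), mem_orbit_self _, ?_⟩
  obtain ⟨h, H⟩ := QuotientGroup.mk_out_eq_mul J x
  rw [H, (mem_orbit_mk_iff J)]
  refine ⟨h⁻¹, ?_⟩
  rw [MulAction.Quotient.smul_mk, smul_eq_mul]
  congr 1
  simp only [Subgroup.coe_inv]
  group

/-- **Multiplicativity of Hecke operators from the expansion property.** If `x J y ⊆ J (xy) J`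
and the double cosets `JxJ`, `JyJ`, `J xy J` are finite unions of left cosets, then on `V^J`
`[JxJ] ([JyJ] v) = N_{x,y}(xyJ) • [J xy J] v`: by the product formula
(`heckeOperator_heckeOperator_apply`) the left side is `∑_γ N_{x,y}(γ) ρ(γ) v`, the structure
constants vanish off `J xy J / J` (`heckePairCount_eq_zero_of_not_mem_orbit_mul`) and are
`J`-invariant (`heckePairCount_smul`), hence constant on it. For the Iwahori or congruence
subgroups and dominant torus elements this is `[JtJ][Jt'J] = c • [J tt' J]` (Casselman (1995),
Lemma 4.1.5; for `GL_n` and `K₁` see `exists_smul_heckeOperator_piPowGL_eq_prod`). [folklore] -/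
theorem heckeOperator_heckeOperator_apply_eq_smul {x y : G}
    (hxy : ∀ j ∈ J, ∃ j₁ ∈ J, ∃ j₂ ∈ J, x * j * y = j₁ * (x * y) * j₂)
    (hx : (orbit J (x : G ⧸ J)).Finite) (hy : (orbit J (y : G ⧸ J)).Finite)
    (hxy' : (orbit J ((x * y : G) : G ⧸ J)).Finite) {v : V} (hv : v ∈ ρ.fixedPoints J) :
    heckeOperator ρ J x (heckeOperator ρ J y v) =
      (heckePairCount J x y ((x * y : G) : G ⧸ J) : k) • heckeOperator ρ J (x * y) v := by
  classical
  rw [heckeOperator_heckeOperator_apply ρ J x y hx hy hv,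
    finsum_eq_sum_of_support_subset _ (s := hxy'.toFinset) ?_]
  · rw [heckeOperator_apply_eq_sum_out ρ J (x * y) hxy' hv, Finset.smul_sum]
    refine Finset.sum_congr rfl fun γ hγ => ?_
    rw [Set.Finite.mem_toFinset] at hγ
    obtain ⟨κ, rfl⟩ := MulAction.mem_orbit_iff.mp hγ
    rw [heckePairCount_smul]
  · intro γ hγ
    rw [Function.mem_support] at hγ
    rw [Finset.mem_coe, Set.Finite.mem_toFinset]
    by_contra h
    exact hγ (by rw [heckePairCount_eq_zero_of_not_mem_orbit_mul J hxy h, Nat.cast_zero,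
      zero_smul])

end Abstract

/-! ### `GL_n`: words in the fundamental operators `[K₁ ϖ^ε K₁]` -/

section GLn

variable {F : Type*} [Field F] [ValuativeRel F] {n : ℕ} {α : Type*} [LinearOrder α]
  {c : Fin n → α}

omit [ValuativeRel F] in
/-- `ϖ^{a + b} = ϖ^a ϖ^b` for `ℕ`-exponents (`piPowGL`); a private copy of
`piPowGL_mul_piPowGL` of `ShintaniWhittakerFormula` (not imported here). [folklore] -/
private theorem piPowGL_add_eq_mul {ϖ : F} (hϖ : ϖ ≠ 0) (a b : Fin n → ℕ) :
    piPowGL hϖ (a + b) = piPowGL hϖ a * piPowGL hϖ b := by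
  have h : (fun i => ((a + b) i : ℤ)) = (fun i => (a i : ℤ)) + fun i => (b i : ℤ) := by
    funext i
    simp
  rw [← zpowDiagGL_natCast, ← zpowDiagGL_natCast, ← zpowDiagGL_natCast, h, zpowDiagGL_add]

omit [ValuativeRel F] in
/-- `ϖ^0 = 1`; a private copy of `piPowGL_zero` of `ShintaniWhittakerFormula` (not imported
here). [folklore] -/
private theorem piPowGL_zero_eq_one {ϖ : F} (hϖ : ϖ ≠ 0) : piPowGL hϖ (0 : Fin n → ℕ) = 1 := by
  have h : (fun i : Fin n => ((0 : Fin n → ℕ) i : ℤ)) = 0 := by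
    funext i
    simp
  rw [← zpowDiagGL_natCast, h, zpowDiagGL_zero]

/-- **The expansion property for `K₁` and dominant `ϖ`-powers** (`ℕ`-exponents): for antitone
`a, b ∈ ℕⁿ` and `j ∈ K₁`, `ϖ^a j ϖ^b = j₁ (ϖ^a ϖ^b) j₂` with `j₁, j₂ ∈ K₁`
(`exists_zpowDiagGL_mul_mul_zpowDiagGL_eq`). [folklore] -/
theorem piPowGL_mul_mul_piPowGL_mem (hc : ∀ i j, c i = c j) {ϖ : F} (hϖ0 : ϖ ≠ 0)
    (hϖ1 : valuation F ϖ ≤ 1) {a b : Fin n → ℕ} (ha : Antitone a) (hb : Antitone b) :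
    ∀ j ∈ proUnipotentGL n F c, ∃ j₁ ∈ proUnipotentGL n F c, ∃ j₂ ∈ proUnipotentGL n F c,
      piPowGL hϖ0 a * j * piPowGL hϖ0 b = j₁ * (piPowGL hϖ0 a * piPowGL hϖ0 b) * j₂ := by
  intro j hj
  have ha' : Antitone fun i => (a i : ℤ) := fun i i' h => Int.ofNat_le.mpr (ha h)
  have hb' : Antitone fun i => (b i : ℤ) := fun i i' h => Int.ofNat_le.mpr (hb h)
  obtain ⟨j₁, hj₁, j₂, hj₂, h⟩ := exists_zpowDiagGL_mul_mul_zpowDiagGL_eq hc hϖ0 hϖ1 ha' hb' hj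
  refine ⟨j₁, hj₁, j₂, hj₂, ?_⟩
  rwa [zpowDiagGL_natCast, zpowDiagGL_natCast] at h

variable {k V : Type*} [CommRing k] [AddCommGroup V] [Module k V]
  (ρ : Representation k (GL (Fin n) F) V)

/-- **Words in the fundamental operators.** Let `J = K₁` (as `proUnipotentGL n F c`, `c`
constant) have finite double cosets `JgJ/J` (e.g. `J` compact open in `GL_n` of a local field).
For an antitone `a ∈ ℕⁿ` with `∑ a_i ≤ m` there are `N ≥ 1` and a word `w = (ε_1, …, ε_ℓ)` of
length `ℓ ≤ m` in the antitone `0/1`-vectors such that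
`N • [J ϖ^a J] v = [J ϖ^{ε_1} J] ( ⋯ ([J ϖ^{ε_ℓ} J] v))` for all `v ∈ V^J`: write
`a = ε + a'` with `ε = min(a, 1)`, use `[J ϖ^ε J][J ϖ^{a'} J] = N₀ • [J ϖ^a J]`
(`heckeOperator_heckeOperator_apply_eq_smul` with `piPowGL_mul_mul_piPowGL_mem`) and induct on
`∑ a_i` (Casselman (1995), Lemma 4.1.5: `[JtJ]`, `t` dominant, is multiplicative up to these
positive integers). [folklore] -/
theorem exists_smul_heckeOperator_piPowGL_eq_prod (hc : ∀ i j, c i = c j) {ϖ : F} (hϖ0 : ϖ ≠ 0)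
    (hϖ1 : valuation F ϖ ≤ 1)
    (hfin : ∀ g : GL (Fin n) F,
      (orbit (proUnipotentGL n F c) (g : GL (Fin n) F ⧸ proUnipotentGL n F c)).Finite)
    (m : ℕ) : ∀ a : Fin n → ℕ, Antitone a → ∑ i, a i ≤ m →
      ∃ (N : ℕ) (w : List (Fin n → ℕ)), 1 ≤ N ∧ w.length ≤ m ∧
        (∀ ε ∈ w, Antitone ε ∧ ∀ i, ε i ≤ 1) ∧
        ∀ v ∈ ρ.fixedPoints (proUnipotentGL n F c),
          (N : k) • heckeOperator ρ (proUnipotentGL n F c) (piPowGL hϖ0 a) v =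
            (w.map fun ε => heckeOperator ρ (proUnipotentGL n F c) (piPowGL hϖ0 ε)).prod v := by
  induction m with
  | zero =>
    intro a _ hsum
    have ha0 : a = 0 := by
      funext i
      have := (Finset.sum_eq_zero_iff.mp (Nat.le_zero.mp hsum)) i (Finset.mem_univ i)
      exact this
    refine ⟨1, [], le_rfl, le_rfl, fun ε hε => by simp at hε, fun v hv => ?_⟩
    rw [ha0, piPowGL_zero_eq_one, heckeOperator_one_apply ρ _ hv, Nat.cast_one, one_smul]
    simp
  | succ m ih =>
    intro a ha hsum
    by_cases hle : ∑ i, a i ≤ m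
    · obtain ⟨N, w, hN, hw, hw', h⟩ := ih a ha hle
      exact ⟨N, w, hN, hw.trans (Nat.le_succ m), hw', h⟩
    -- `∑ a = m + 1 > 0`: peel off `ε = min(a, 1)`
    set ε : Fin n → ℕ := fun i => min (a i) 1 with hε
    set a' : Fin n → ℕ := fun i => a i - 1 with ha'
    have hdec : a = ε + a' := by
      funext i
      simp only [Pi.add_apply, hε, ha']
      omega
    have hεanti : Antitone ε := fun i j h => min_le_min_right 1 (ha h)
    have hεle : ∀ i, ε i ≤ 1 := fun i => min_le_right _ _
    have ha'anti : Antitone a' := fun i j h => Nat.sub_le_sub_right (ha h) 1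
    obtain ⟨i₀, -, hi₀⟩ := Finset.exists_ne_zero_of_sum_ne_zero
      (show ∑ i, a i ≠ 0 by omega)
    have hεi₀ : ε i₀ = 1 := by
      simp only [hε]
      omega
    have hsumε : 1 ≤ ∑ i, ε i := by
      rw [← hεi₀]
      exact Finset.single_le_sum (fun i _ => Nat.zero_le (ε i)) (Finset.mem_univ i₀)
    have hsum' : ∑ i, a' i ≤ m := by
      have hsplit : ∑ i, a i = ∑ i, ε i + ∑ i, a' i := by
        rw [← Finset.sum_add_distrib]
        exact Finset.sum_congr rfl fun i _ => congrFun hdec i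
      omega
    obtain ⟨N', w', hN', hw', hw'', h'⟩ := ih a' ha'anti hsum'
    have hprod : piPowGL hϖ0 ε * piPowGL hϖ0 a' = piPowGL hϖ0 a := by
      rw [← piPowGL_add_eq_mul, ← hdec]
    have hN₀1 : 1 ≤ heckePairCount (proUnipotentGL n F c) (piPowGL hϖ0 ε) (piPowGL hϖ0 a')
        ((piPowGL hϖ0 a : GL (Fin n) F) : GL (Fin n) F ⧸ proUnipotentGL n F c) := by
      have h1 := one_le_heckePairCount_mul (proUnipotentGL n F c) (piPowGL hϖ0 ε) (piPowGL hϖ0 a')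
        (hfin _)
      rwa [hprod] at h1
    refine ⟨heckePairCount (proUnipotentGL n F c) (piPowGL hϖ0 ε) (piPowGL hϖ0 a')
        ((piPowGL hϖ0 a : GL (Fin n) F) : GL (Fin n) F ⧸ proUnipotentGL n F c) * N', ε :: w',
      Nat.one_le_iff_ne_zero.mpr (Nat.mul_ne_zero (Nat.one_le_iff_ne_zero.mp hN₀1)
        (Nat.one_le_iff_ne_zero.mp hN')),
      by rw [List.length_cons]; omega, ?_, fun v hv => ?_⟩
    · intro δ hδ
      rw [List.mem_cons] at hδ
      rcases hδ with rfl | hδ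
      · exact ⟨hεanti, hεle⟩
      · exact hw'' δ hδ
    · have hmul := heckeOperator_heckeOperator_apply_eq_smul ρ (proUnipotentGL n F c)
        (piPowGL_mul_mul_piPowGL_mem hc hϖ0 hϖ1 hεanti ha'anti) (hfin _) (hfin _) (hfin _) hv
      rw [hprod] at hmul
      rw [List.map_cons, List.prod_cons, Module.End.mul_apply, ← h' v hv, map_smul, hmul,
        smul_smul, Nat.cast_mul, mul_comm]

end GLn

end Literature.NumberTheory.Automorphic
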